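import Literature.Analysis.FluidPDE.LeiZhang2017AxisymmetricCriteria
import HarnessLib

/-!
# Lei–Navas–Zhang 2016: a priori bounds on the velocity and on `ω_θ` near the axis for
# axisymmetric Navier–Stokes solutions, and the criterion `|v_z| ≤ C/r`

Topic `Literature/Analysis/FluidPDE`; named facts (results in print, `def … : Prop`, D-0014) with
proved elementary consequences, typed by the NS literature harvest (D-0081 §A4 topic (4),
axisymmetric) for the Type-II-exclusion estimate seats (§B: "an a-priori estimate excluding Type-II
first blow-up in a named class"; hard core `AxisymSwirlRegular`, stmt-…-1964; residual `NoTypeII`).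
These are UNCONDITIONAL a priori bounds for axisymmetric solutions with swirl — print's "exact gap
between what we have and what we need" (the regularity threshold being `|v| ≤ C/r`,
`knss_bound_C_over_r`).

Source: Z. Lei, E. A. Navas, Q. S. Zhang, *A priori bound on the velocity in axially symmetric
Navier–Stokes equations*, Comm. Math. Phys. 341 (2016) 289–307 = arXiv:1309.6625 (held text; §1
Thms. 1–2 and Remark 1.1, §4 Appendix Props. 2–3); restated as Thms. 2.3–2.5 of Q. S. Zhang's
review, Anal. Theory Appl. 38 (2022) = arXiv:2101.04905, §2.1.

> **Theorem 1.** Suppose `v` is a smooth, axially symmetric solution of the three-dimensional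
> Navier–Stokes equations in `ℝ³ × (−T, 0)` with initial data `v₀ = v(·, −T) ∈ L²(ℝ³)`. Assume
> further `r v_{0,θ} ∈ L^∞(ℝ³)` and let `R = min{1, √(T/2)}`. Then for all
> `(x, t) ∈ ℝ³ × (−R², 0)`, it holds `|v_r(x,t)| + |v_z(x,t)| ≤ C√|ln r| / r²`,
> `0 < r ≤ min{1/2, R}`. Here `r` is the distance from `x` to the `z` axis, and `C` is a constant
> depending only on the initial data.
>
> **Theorem 2.** [same hypotheses] There is a constant `C`, depending only on the initial data,
> such that the following holds for all `(x, t) ∈ ℝ³ × (−R², 0)` with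
> `r = |x'| ∈ (0, min{R, 1/2})`:
> `|ω_θ(x,t)| ≤ (C ln(1/r) / r^{7/2}) [sup_{s ∈ [t−r², t]} (∫_{B(x,4r)} (v_r² + v_z²)(y,s) dy)^{1/2}
>   + r^{1/2}(‖r v_{0,θ}‖_{L^∞(ℝ³)} + 1)]² × [(∫_{t−r²}^t ∫_{B(x,4r)} ω_θ²(y,s) dy ds)^{1/2}
>   + r^{1/2}(‖r v_{0,θ}‖_{L^∞(ℝ³)} + 1)]`.
>
> **Remark 1.1.** […] the bound on `ω_θ` is scaling invariant.
>
> **Proposition 2 (Appendix).** Let `v` be a Leray–Hopf solution to (ASNS) in `ℝ³ × (0, ∞)` such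
> that `r v_{0,θ} ∈ L^∞(ℝ³)`. Suppose, for a given constant `C > 0`, and all `x ∈ ℝ³` and `t ≥ 0`,
> `|v_z(x,t)| ≤ C/r`. Then `v` is regular for all time.

* `LeiNavasZhang2016.window T = min 1 √(T/2)` (print's `R`);
  `LeiNavasZhang2016.localPoloidalEnergy`, `.localSwirlVorticityEnergy` — the two local
  quantities of Thm. 2 (in `ℝ≥0∞`).
* `LeiNavasZhang2016_velocityBound` — **Thm. 1**; `LeiNavasZhang2016_vorticityBound` — **Thm. 2**;
  `LeiNavasZhang2016_axialVelocity_regularity` — **Prop. 2**.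
* Proved: `LeiNavasZhang2016.window_pos`, `.window_le_one`, `.window_sq_le`, `.sub_sq_pos`
  (the time window `(T − R², T)` and the memory interval `[t − r², t]` lie inside `(0, T)`), and
  `LeiNavasZhang2016_velocityBound.norm_poloidal_le` (the bound controls
  `√(v_r² + v_z²) ≤ |v_r| + |v_z|`).

## Rendering (a special case of the printed statements, never stronger)

Thms. 1–2 are rendered in the continuation frame of the accepted axisymmetric criteria
(`LeiZhang2017AxisymmetricCriteria.lean`), time-shifted from print's `(−T, 0)` to `[0, T)`: a
classical solution `(u, p)` of Navier–Stokes (`ν = 1`, `f = 0`) on `[0, T) × ℝ³`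
(`IsClassicalNSSolutionOn (Ico 0 T) 1 0 u p`; print: "smooth solution"), Leray–Hopf from its datum
(`IsLerayHopfOn T 1 0 (u 0) u`; print: "initial data `∈ L²`", the energy inequality being what the
proof uses), the datum rapidly decaying (`HasRapidSpatialDecay (u 0)`, whence `r v_{0,θ} ∈ L^∞`,
`HasRapidSpatialDecay.eLpNorm_swirl_lt_top` — a SMALLER data class than print's, so the facts are
weaker), every slice `u t`, `t ∈ [0, T)`, axisymmetric (`IsAxisymmetric`).  The bounds are asserted
on print's window `t ∈ (T − R², T)`, `R = min{1, √(T/2)}`, up to the possibly singular time `T`,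
with a constant `C` quantified AFTER the solution ("depending only on the initial data": for a
classical solution the datum determines the solution, so `∃ C` per solution is the printed
dependence; no uniformity across data is claimed).  `v_r = radialVelocity`, `v_z = axialVelocity`,
`ω_θ = swirlVelocity (curl ·)`, `r = cylRadius`, `Γ = swirl` are the accepted ones (junk `0` of
`v_r`, `ω_θ` on the axis, where the bounds are not asserted: `0 < r`).  Thm. 2 is written in `ℝ≥0∞`
(`‖ω_θ‖ₑ ≤ …` with `lintegral`s over `Metric.ball x (4r)` and the `⨆` over `s ∈ [t − r², t]`), so no
finiteness side conditions are needed; `‖r v_{0,θ}‖_∞` enters as `(eLpNorm (swirl (u 0)) ∞).toReal`.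
Prop. 2 is rendered in the accepted Leray–Hopf frame of `ladyzhenskaya_prodi_serrin`
(`NSLerayHopf.lean`): a global Leray–Hopf solution `u` (`IsGlobalLerayHopf 1 0 u₀ u`) from an `L²`
datum with `r u_{0,θ} ∈ L^∞`, axisymmetric slices and `|v_z(t,x)| ≤ C/r` for all `t ≥ 0` and all
`x` off the axis (print: all `x`, with `C/0 = +∞` on the axis — a null set for the a.e.-defined
field; Lean's junk `C/0 = 0` would instead demand `v_z = 0` there, so the axis is excluded), is
"regular for all time": for every `T > 0` there is a classical solution on `(0, T]` agreeing with
`u` a.e. on every slice.  (The local-in-time version — bound on `(0, T)` ⇒ smooth on `(0, T]` — is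
Chen–Fang–Zhang 2017 Cor. 1.5, `ChenFangZhang2017_boundedRAxial_regularity`.)  Viscosity `ν = 1`
as printed.  Not restated: Prop. 3 (the bound `|L_θ| ≤ C|ln r|^{1/2} r^{−1/2}` on the angular
stream function — the tree has no canonical angular stream function yet), §2–§3 (proofs).

## Mathlib / tree search

Mathlib has no Navier–Stokes theory.  `lean search 'Navas|1309.6625|LeiNavasZhang'` (2026-08-26):
no declaration, no docstring mention; bib key `LeiNavasZhang2016` added for this file.  Reused:
`IsClassicalNSSolutionOn` (`ClassicalSolution.lean`), `IsLerayHopfOn`, `IsGlobalLerayHopf`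
(`LerayHopf.lean`), `HasRapidSpatialDecay` (`NSWave0.lean`), `IsAxisymmetric`, `cylRadius`,
`radialVelocity`, `axialVelocity`, `swirlVelocity`, `swirl`, `curl` (`AxisymmetricEuler.lean`,
`VectorCalculus.lean`).  Neighbours: `knss_bound_C_over_r` / `KNSS2009_regularity_bound_C_over_r_holds`
(the threshold `|v| ≤ C/r`), `LeiZhang2011_regularity_bmoStream_holds` (the engine of Prop. 2),
`ChenFangZhang2017_boundedRAxial_regularity`, `Seregin2020_axisymmetricSingularPoint_typeII`.

## References

* Z. Lei, E. A. Navas, Q. S. Zhang, Comm. Math. Phys. 341 (2016) 289–307, arXiv:1309.6625: §1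
  Thm. 1, Thm. 2, Remark 1.1; §4 (Appendix) Prop. 2, Prop. 3. [`LeiNavasZhang2016`]
* Q. S. Zhang (with an addendum by X. Pan and Q. Zhang), Anal. Theory Appl. 38 (2022),
  arXiv:2101.04905, §2.1 Thms. 2.3–2.5 (restatement). [`ZhangPan2022`]
* Z. Lei, Q. S. Zhang, J. Funct. Anal. 261 (2011) 2323–2345, Thm. 1.4. [`LeiZhang2011`]
-/

noncomputable section

open MeasureTheory Set Function Filter
open _root_.Topology
open scoped NNReal ENNReal

namespace Literature.Analysis.FluidPDE

/-- Local notation for physical space `ℝ³ = EuclideanSpace ℝ (Fin 3)`. -/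
local notation "ℝ³" => EuclideanSpace ℝ (Fin 3)

namespace LeiNavasZhang2016

/-- Print's `R = min{1, √(T/2)}` (Lei–Navas–Zhang 2016, Thm. 1): the bounds hold on the final time
window of length `R²` and for `r ≤ min{1/2, R}`. [cite: LeiNavasZhang2016, Thm. 1] -/
def window (T : ℝ) : ℝ :=
  min 1 (Real.sqrt (T / 2))

/-- The local poloidal energy `∫_{B(x,ρ)} (v_r² + v_z²)(y, s) dy ∈ [0, ∞]` of the slice `u s`
(Lei–Navas–Zhang 2016, Thm. 2, first bracket). [cite: LeiNavasZhang2016, Thm. 2] -/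
def localPoloidalEnergy (u : ℝ → ℝ³ → ℝ³) (x : ℝ³) (ρ s : ℝ) : ℝ≥0∞ :=
  ∫⁻ y in Metric.ball x ρ, ENNReal.ofReal (radialVelocity (u s) y ^ 2 + axialVelocity (u s) y ^ 2)

/-- The local space–time `L²` mass `∫_{t₁}^{t₂} ∫_{B(x,ρ)} ω_θ²(y, s) dy ds ∈ [0, ∞]` of the angular
vorticity `ω_θ = swirlVelocity (curl (u s))` (Lei–Navas–Zhang 2016, Thm. 2, second bracket). [cite: LeiNavasZhang2016, Thm. 2] -/
def localSwirlVorticityEnergy (u : ℝ → ℝ³ → ℝ³) (x : ℝ³) (ρ t₁ t₂ : ℝ) : ℝ≥0∞ :=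
  ∫⁻ s in Ioo t₁ t₂, ∫⁻ y in Metric.ball x ρ, ENNReal.ofReal (swirlVelocity (curl (u s)) y ^ 2)

/-- `R > 0` for `T > 0`. [cite: LeiNavasZhang2016, Thm. 1] -/
theorem window_pos {T : ℝ} (hT : 0 < T) : 0 < window T :=
  lt_min zero_lt_one (Real.sqrt_pos.2 (by linarith))

/-- `R ≤ 1`. [cite: LeiNavasZhang2016, Thm. 1] -/
theorem window_le_one (T : ℝ) : window T ≤ 1 :=
  min_le_left _ _

/-- `R² ≤ T/2`: the window `(T − R², T)` starts after half the lifetime. [cite: LeiNavasZhang2016, Thm. 1] -/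
theorem window_sq_le {T : ℝ} (hT : 0 < T) : window T ^ 2 ≤ T / 2 := by
  have h1 : window T ≤ Real.sqrt (T / 2) := min_le_right _ _
  have h0 : 0 ≤ window T := (window_pos hT).le
  calc window T ^ 2 ≤ Real.sqrt (T / 2) ^ 2 := by gcongr
    _ = T / 2 := Real.sq_sqrt (by linarith)

/-- The memory interval of Thm. 2 lies inside the lifetime: for `t > T − R²` and `0 < r < R`,
`0 < t − r²` (print: `t − r² > −T` on `(−T, 0)`). [cite: LeiNavasZhang2016, Thm. 2] -/
theorem sub_sq_pos {T t r : ℝ} (hT : 0 < T) (ht : T - window T ^ 2 < t) (hr : 0 < r)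
    (hrR : r < window T) : 0 < t - r ^ 2 := by
  have h1 : r ^ 2 < window T ^ 2 := by gcongr
  have h2 := window_sq_le hT
  linarith

end LeiNavasZhang2016

open LeiNavasZhang2016

/-! ### The named facts -/

/-- **Lei–Navas–Zhang 2016, Theorem 1: a priori velocity bound near the axis.**  "Suppose `v` is a
smooth, axially symmetric solution of the three-dimensional Navier–Stokes equations in
`ℝ³ × (−T, 0)` with initial data `v₀ = v(·, −T) ∈ L²(ℝ³)`. Assume further `r v_{0,θ} ∈ L^∞(ℝ³)`
and let `R = min{1, √(T/2)}`. Then for all `(x, t) ∈ ℝ³ × (−R², 0)`, it holds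
`|v_r(x,t)| + |v_z(x,t)| ≤ C√|ln r| / r²`, `0 < r ≤ min{1/2, R}` […] `C` is a constant depending
only on the initial data."  Rendered (module docstring) on `[0, T)` for classical Leray–Hopf
solutions from a rapidly decaying datum with axisymmetric slices: there is `C` such that the bound
holds for all `t ∈ (T − R², T)` and all `x` with `0 < r = cylRadius x ≤ min{1/2, R}` — uniformly up
to the (possibly singular) time `T`. [cite: LeiNavasZhang2016, Thm. 1] -/
def LeiNavasZhang2016_velocityBound : Prop :=
  ∀ (T : ℝ) (u : ℝ → ℝ³ → ℝ³) (p : ℝ → ℝ³ → ℝ), 0 < T →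
    IsClassicalNSSolutionOn (Ico 0 T) 1 0 u p → IsLerayHopfOn T 1 0 (u 0) u →
    HasRapidSpatialDecay (u 0) → (∀ t ∈ Ico 0 T, IsAxisymmetric (u t)) →
    ∃ C : ℝ, ∀ t ∈ Ioo (T - window T ^ 2) T, ∀ x : ℝ³, 0 < cylRadius x →
      cylRadius x ≤ min (1 / 2) (window T) →
      |radialVelocity (u t) x| + |axialVelocity (u t) x| ≤
        C * Real.sqrt |Real.log (cylRadius x)| / cylRadius x ^ 2

/-- **Lei–Navas–Zhang 2016, Theorem 2: the scale-invariant a priori bound on `ω_θ`.**  Under the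
hypotheses of Thm. 1, "there is a constant `C`, depending only on the initial data, such that the
following holds for all `(x, t) ∈ ℝ³ × (−R², 0)` with `r = |x'| ∈ (0, min{R, 1/2})`:
`|ω_θ(x,t)| ≤ (C ln(1/r) / r^{7/2}) [sup_{s ∈ [t−r², t]} (∫_{B(x,4r)} (v_r² + v_z²)(y,s) dy)^{1/2}
+ r^{1/2}(‖r v_{0,θ}‖_{L^∞} + 1)]² × [(∫_{t−r²}^t ∫_{B(x,4r)} ω_θ²(y,s) dy ds)^{1/2}
+ r^{1/2}(‖r v_{0,θ}‖_{L^∞} + 1)]`" (Remark 1.1: "the bound on `ω_θ` is scaling invariant").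
Rendered (module docstring) on `[0, T)` in the same frame as Thm. 1, in `ℝ≥0∞` (both sides as
extended nonnegative reals; `B(x, 4r) = Metric.ball x (4r)`, the memory interval `[t − r², t] ⊂ (0, T)`
by `LeiNavasZhang2016.sub_sq_pos`). [cite: LeiNavasZhang2016, Thm. 2] -/
def LeiNavasZhang2016_vorticityBound : Prop :=
  ∀ (T : ℝ) (u : ℝ → ℝ³ → ℝ³) (p : ℝ → ℝ³ → ℝ), 0 < T →
    IsClassicalNSSolutionOn (Ico 0 T) 1 0 u p → IsLerayHopfOn T 1 0 (u 0) u →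
    HasRapidSpatialDecay (u 0) → (∀ t ∈ Ico 0 T, IsAxisymmetric (u t)) →
    ∃ C : ℝ, 0 ≤ C ∧ ∀ t ∈ Ioo (T - window T ^ 2) T, ∀ x : ℝ³, 0 < cylRadius x →
      cylRadius x < min (window T) (1 / 2) →
      ‖swirlVelocity (curl (u t)) x‖ₑ ≤
        ENNReal.ofReal (C * Real.log (1 / cylRadius x) / cylRadius x ^ (7 / 2 : ℝ)) *
          ((⨆ s ∈ Icc (t - cylRadius x ^ 2) t,
              localPoloidalEnergy u x (4 * cylRadius x) s ^ (1 / 2 : ℝ)) +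
            ENNReal.ofReal (Real.sqrt (cylRadius x) *
              ((eLpNorm (swirl (u 0)) ∞ volume).toReal + 1))) ^ 2 *
          (localSwirlVorticityEnergy u x (4 * cylRadius x) (t - cylRadius x ^ 2) t ^ (1 / 2 : ℝ) +
            ENNReal.ofReal (Real.sqrt (cylRadius x) *
              ((eLpNorm (swirl (u 0)) ∞ volume).toReal + 1)))

/-- **Lei–Navas–Zhang 2016, Appendix, Proposition 2: `|v_z| ≤ C/r` implies regularity.**  "Let `v`
be a Leray–Hopf solution to (ASNS) in `ℝ³ × (0, ∞)` such that `r v_{0,θ} ∈ L^∞(ℝ³)`. Suppose,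
for a given constant `C > 0`, and all `x ∈ ℝ³` and `t ≥ 0`, `|v_z(x, t)| ≤ C/r`. Then `v` is
regular for all time" (proof: the angular stream function is bounded, then Lei–Zhang 2011).
Rendered (module docstring) in the Leray–Hopf frame of `ladyzhenskaya_prodi_serrin`: a global
Leray–Hopf solution (`ν = 1`, no force) with axisymmetric slices, `r u_{0,θ} ∈ L^∞` and the bound
off the axis for all `t ≥ 0` admits, for every `T > 0`, a classical representative on `(0, T]`. [cite: LeiNavasZhang2016, Prop. 2 (Appendix)] -/
def LeiNavasZhang2016_axialVelocity_regularity : Prop :=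
  ∀ (C : ℝ) (u₀ : ℝ³ → ℝ³) (u : ℝ → ℝ³ → ℝ³), 0 < C →
    IsGlobalLerayHopf 1 0 u₀ u → eLpNorm (swirl u₀) ∞ volume < ∞ →
    (∀ t : ℝ, 0 ≤ t → IsAxisymmetric (u t)) →
    (∀ t : ℝ, 0 ≤ t → ∀ x : ℝ³, 0 < cylRadius x → |axialVelocity (u t) x| ≤ C / cylRadius x) →
    ∀ T : ℝ, 0 < T → ∃ (w : ℝ → ℝ³ → ℝ³) (p : ℝ → ℝ³ → ℝ),
      IsClassicalNSSolutionOn (Ioc 0 T) 1 0 w p ∧ ∀ t ∈ Ioc 0 T, u t =ᵐ[volume] w t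

/-! ### Proved consequences -/

/-- `√(v_r² + v_z²) ≤ |v_r| + |v_z|`: the velocity bound of Thm. 1 controls the modulus of the
poloidal velocity `b = v_r e_r + v_z e_z` at the same rate `C√|ln r|/r²`. Conditional on the fact. [cite: LeiNavasZhang2016, Thm. 1] -/
theorem LeiNavasZhang2016_velocityBound.sqrt_sq_add_sq_le (h : LeiNavasZhang2016_velocityBound)
    {T : ℝ} {u : ℝ → ℝ³ → ℝ³} {p : ℝ → ℝ³ → ℝ} (hT : 0 < T)
    (hns : IsClassicalNSSolutionOn (Ico 0 T) 1 0 u p) (hlh : IsLerayHopfOn T 1 0 (u 0) u)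
    (hdec : HasRapidSpatialDecay (u 0)) (hax : ∀ t ∈ Ico 0 T, IsAxisymmetric (u t)) :
    ∃ C : ℝ, ∀ t ∈ Ioo (T - window T ^ 2) T, ∀ x : ℝ³, 0 < cylRadius x →
      cylRadius x ≤ min (1 / 2) (window T) →
      Real.sqrt (radialVelocity (u t) x ^ 2 + axialVelocity (u t) x ^ 2) ≤
        C * Real.sqrt |Real.log (cylRadius x)| / cylRadius x ^ 2 := by
  obtain ⟨C, hC⟩ := h T u p hT hns hlh hdec hax
  refine ⟨C, fun t ht x hr hrR => le_trans ?_ (hC t ht x hr hrR)⟩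
  rw [Real.sqrt_le_left (by positivity)]
  nlinarith [abs_nonneg (radialVelocity (u t) x), abs_nonneg (axialVelocity (u t) x),
    sq_abs (radialVelocity (u t) x), sq_abs (axialVelocity (u t) x)]

/-- The time window of Thms. 1–2 is a nonempty subinterval of the lifetime: `0 ≤ T − R² < T`. [cite: LeiNavasZhang2016, Thm. 1] -/
theorem LeiNavasZhang2016.window_Ioo_subset {T : ℝ} (hT : 0 < T) :
    Ioo (T - window T ^ 2) T ⊆ Ioo 0 T ∧ (Ioo (T - window T ^ 2) T).Nonempty := by
  have h2 := window_sq_le hT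
  have hpos : 0 < window T ^ 2 := pow_pos (window_pos hT) 2
  exact ⟨Ioo_subset_Ioo (by linarith) le_rfl, nonempty_Ioo.2 (by linarith)⟩

end Literature.Analysis.FluidPDE

end
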